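import Summits.Ventures.HSemireg.WedgeWeilPurityBlockForms

/-!
# Venture HSemireg — W-PURITY(ρ), compression (2/2): `ψ₋ψ₊ ∣ E₊` compressed to the `(n+1)`-dimensional type space, closed form

HONEST FRAMING. Part of the Lean index of the computation cell `pub-hsemireg` (second enclosure wave; this file is seat p6's own
text, gen 8, in the conventions of seat p3's ENCLOSURE-PLAN-p3.md).  Finite-dimensional exterior algebra over a field ONLY:
no variety, no cohomology theory, no semiregularity map is constructed here; nothing here says that HC / HC_CM / HC_AV holds;
no Literature fact is declared or used.  The geometric DICTIONARY (why these ranks are the `HT`-side box ranks of the cell's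
STRUCTURE.md §1 / theory/FORMULA-N.md) lives in theory/FORMULA-N-th7.md PART B §A.3 / §N and is NOT asserted in Lean.

WHAT THESE TWO FILES PROVE (file 1 = `WedgeWeilPurityBlockForms.lean`: `op`, `Wb`, `eps`, `f_eq_sum_eps`, `eps_mul_eps`) — the one identity of th-7's W-PURITY(ρ) that `theory/th7/W-PURITY-RHO-DERIVATION-th7.md` §5 lists as
«NOT in the kernel» (Step 4, second half: the compression of `ψ₋ψ₊ ∣ E₊` to the `(n+1)`-dimensional type space), for the Weil
model of type `(n,n)` of `WedgeWeil*.lean` / `WedgeWeilPuritySchur.lean` (`E₊ = Hom(Gm) n = ⋀ⁿV₊`, `E₋ = Hom(Dm) n`, `f = w_{2n}(q)`,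
`ψ₊ = σ_{Gm}∘(∧f)`, `ψ₋ = σ_{Dm}∘(∧f)`, `ρ = rank H_n(q)`), EVERY `q`, EVERY field, no characteristic hypothesis:
* `f_eq_sum_eps` — the BILINEAR SPLIT of the h-part, `w_{2n}(q) = Σ_{j,l ≤ n} q_{j+l} · eps₋ j · eps₊ l`, where
  `eps s m j = Σ_{S ⊆ [0,m), |S| = j} Π_{a<m} (y_{s+a} if a ∈ S else x_{s+a})` are the «elementary» block forms in the model's own
  ordered-product convention (`eps₋ = eps 0 n`, `eps₊ = eps n n`; from the closed form `G`/`w_eq_G` by a concatenation lemma `Wb_add`);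
* `psiP_eq` / `psiM_eq` — **`ψ₊ ∣ E₊ = (−1)^{n·n} · ι₋ ∘ H ∘ Φ₊`** and **`ψ₋ ∣ E₋ = ι₊ ∘ H ∘ Φ₋`**, with `H = Hsq n q = (q_{i+j})_{i,j ≤ n}`,
  `ι± x = Σ x_l eps± l`, `Φ±_l(θ)` = the `E_{Gm}` / `E_{Dm}`-coordinate of `θ ∧ eps± l` (only graded commutation of homogeneous elements
  and `Hom(D) |D| = K · E_D` are used);
* `eps_mul_eps` — THE ONE SIGN COMPUTATION: `eps j' · eps j = [j' + j = m] · (−1)^{C(m,2)+j'} · C(m,j') · Π(x_c ∧ y_c)` (pair-interleaving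
  induction `op_mul_op_compl`; a shared letter kills the product, `op_mul_op_eq_zero`), whence with `WedgeWeilPurityLocus.B_Dm_eq/B_Gm_eq`
  (`Π(x_c∧y_c) = (−1)^{C(n,2)} E_D`): **`Φ₋∘ι₋ = Φ₊∘ι₊ = Ω′`**, `Ω′_{j,j'} = [j + j' = n](−1)^{j'} C(n,j')` (`phiM_eps`, `phiP_eps`);
* `psiM_psiP_eq` — `ψ₋ψ₊ ∣ E₊ = ι₊ ∘ M(q) ∘ Φ₊`, `M(q) = (−1)^{n·n} H Ω′ H`; and for `u ≠ 0` the KERNEL CORRESPONDENCE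
  **`EP_inf_ker_schurOp_eq`**: `E₊ ⊓ ker(ψ₋ψ₊ − u) = ι₊(ker(S(q) − u))`, `S(q) := M(q) Ω′ = (−1)^{n·n} H Ω′ H Ω′` (`Scomp`), with `ι₊` injective
  there, so **`finrank_EP_inf_ker_schurOp`**: `dim(E₊ ⊓ ker(ψ₋ψ₊ − u)) = dim ker(S(q) − u·1)`;
* **`weilPurity_closedForm`** (with th-7's `weilPurity_schur`): for `n ≥ 1`, `a ≠ 0`, `b ≠ 0`, every `q`, every field,
  `finrank range(∧v ∣ HTⁿ) + 2ρ + dim ker(S(q) − ab) = C(2n,n)·ρ + 2·C(2n,n)`, i.e. rank `= C(2n,n)(2+ρ) − 2ρ − dim ker(S(q) − ab)`;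
* `Scomp_eq` — `S(q) = (−1)ⁿ (H_n(q) Ω_n)(H_n(q) Ω_n)` with th-7's `Ω_n = ((−1)^{n−m} C(n,m) δ_{l,n−m})` VERBATIM (so the constant `κ_n`
  of the derivation is `1` in the kernel).
Consequently the «exceptional set» `Λ(q)` of `weilPurity_locus` (WedgeWeilPurityExceptional.lean) is `Spec≠0 S(q)`, with drop
`dim ker(S(q) − ab)` (geometric multiplicity) — the printed shape (γ)(δ) of W-PURITY(ρ) is a kernel theorem in closed form.
Checks at p6 g8 (2026-08-23): tree-prefix chain rc 0 · 0 · 0, `#print axioms weilPurity_closedForm` = [propext, Classical.choice,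
Quot.sound]; negative controls NC1 (drop the sign `(−1)^{j'}` in `Ω′`) rc 1 at `phiM_eps`/`phiP_eps`/`Omega'_eq`, NC2 (parity exponent
`j' ↦ j` in `eps_mul_eps`) rc 1 at `eps_mul_eps`.  th-7's exact machine check of the same identity at n ≤ 4 (purity4/schur_spectrum.py)
and rank numerics ×2 codes n ≤ 6 are the independent legs.
-/

open Module Set Set.powersetCard Summit.Ventures.HSemireg.Wedge.Hankel

namespace Summit.Ventures.HSemireg.Wedge.Weil

variable (K : Type*) [Field K]

section Compression

variable {n : ℕ}

open Summit.Ventures.HSemireg.Wedge.WeilPurity (pp XX YY YX r r_mul_r B_Dm_eq B_Gm_eq card_Dm_nn card_Gm_nn)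

/-! ### Graded commutation and top-degree coefficients -/

/-- homogeneous elements commute up to the parity sign `(−1)^{d d'}`. -/
lemma comm_of_mem_Hom {D D' : Finset (In (n + n))} {d d' : ℕ} {θ f : HT K (In (n + n))}
    (hθ : θ ∈ Hom K (In (n + n)) D d) (hf : f ∈ Hom K (In (n + n)) D' d') :
    θ * f = ((-1 : K) ^ (d * d')) • (f * θ) := by
  induction hθ using Submodule.span_induction with
  | mem x hx =>
    obtain ⟨t, ht, rfl⟩ := hx
    rw [B_mul_comm_of_mem_Hom K hf, ht.2]
  | zero => rw [zero_mul, mul_zero, smul_zero]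
  | add x y _ _ hx hy => rw [add_mul, mul_add, hx, hy, smul_add]
  | smul c x _ hx => rw [smul_mul_assoc, mul_smul_comm, hx, smul_comm]

/-- an element of top degree on a block is a multiple of the block monomial, the multiple being its coordinate. -/
lemma eq_coord_smul_B {D : Finset (In (n + n))} {d : ℕ} (hd : d = D.card) {x : HT K (In (n + n))}
    (hx : x ∈ Hom K (In (n + n)) D d) : x = ((B K (In (n + n))).coord D x) • B K (In (n + n)) D := by
  induction hx using Submodule.span_induction with
  | mem y hy =>
    obtain ⟨t, ht, rfl⟩ := hy
    have htD : t = D := Finset.eq_of_subset_of_card_le ht.1 (le_of_eq (by rw [ht.2, hd]))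
    rw [htD, Basis.coord_apply, Basis.repr_self, Finsupp.single_eq_same, one_smul]
  | zero => rw [map_zero, zero_smul]
  | add y z _ _ hy hz => rw [map_add, add_smul, ← hy, ← hz]
  | smul c y _ hy => rw [map_smul, smul_eq_mul, mul_smul, ← hy]

variable (n) in
/-- `φ₊_l(θ)` := the `E_{Gm}`-coordinate of `θ ∧ eps₊ l`. -/
noncomputable def phiP (l : ℕ) : HT K (In (n + n)) →ₗ[K] K :=
  (B K (In (n + n))).coord (Gm (n + n) n) ∘ₗ LinearMap.mulRight K (eps K n n n l)

variable (n) in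
/-- `φ₋_j(θ)` := the `E_{Dm}`-coordinate of `θ ∧ eps₋ j`. -/
noncomputable def phiM (j : ℕ) : HT K (In (n + n)) →ₗ[K] K :=
  (B K (In (n + n))).coord (Dm (n + n) n) ∘ₗ LinearMap.mulRight K (eps K n 0 n j)

/-- unfolding of `φ₊_l`. -/
lemma phiP_apply (l : ℕ) (θ : HT K (In (n + n))) :
    phiP K n l θ = (B K (In (n + n))).coord (Gm (n + n) n) (θ * eps K n n n l) := rfl

/-- unfolding of `φ₋_j`. -/
lemma phiM_apply (j : ℕ) (θ : HT K (In (n + n))) :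
    phiM K n j θ = (B K (In (n + n))).coord (Dm (n + n) n) (θ * eps K n 0 n j) := rfl

/-- `θ₊ ∧ eps₊ l = φ₊_l(θ₊) · E_{Gm}` for `θ₊ ∈ E₊`. -/
lemma EP_mul_eps (l : ℕ) {θ : HT K (In (n + n))} (hθ : θ ∈ Hom K (In (n + n)) (Gm (n + n) n) n) :
    θ * eps K n n n l = phiP K n l θ • B K (In (n + n)) (Gm (n + n) n) := by
  rw [phiP_apply]
  exact eq_coord_smul_B K (by rw [card_Gm_nn]) (mul_mem_Hom K hθ (eps_mem_Hom_Gm K l))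

/-- `θ₋ ∧ eps₋ j = φ₋_j(θ₋) · E_{Dm}` for `θ₋ ∈ E₋`. -/
lemma EM_mul_eps (j : ℕ) {θ : HT K (In (n + n))} (hθ : θ ∈ Hom K (In (n + n)) (Dm (n + n) n) n) :
    θ * eps K n 0 n j = phiM K n j θ • B K (In (n + n)) (Dm (n + n) n) := by
  rw [phiM_apply]
  exact eq_coord_smul_B K (by rw [card_Dm_nn]) (mul_mem_Hom K hθ (eps_mem_Hom_Dm K j))

/-! ### The type maps `ι±` and the Hankel matrix -/

variable (n) in
/-- `ι₊ x := Σ_l x_l · eps₊ l` (into `E₊`). -/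
noncomputable def iotaP : (Fin (n + 1) → K) →ₗ[K] HT K (In (n + n)) :=
  Fintype.linearCombination K fun l : Fin (n + 1) => eps K n n n l

variable (n) in
/-- `ι₋ x := Σ_j x_j · eps₋ j` (into `E₋`). -/
noncomputable def iotaM : (Fin (n + 1) → K) →ₗ[K] HT K (In (n + n)) :=
  Fintype.linearCombination K fun j : Fin (n + 1) => eps K n 0 n j

variable (n) in
/-- `Φ₊ θ := (φ₊_l θ)_l`. -/
noncomputable def PhiP : HT K (In (n + n)) →ₗ[K] (Fin (n + 1) → K) :=
  LinearMap.pi fun l : Fin (n + 1) => phiP K n l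

variable (n) in
/-- `Φ₋ θ := (φ₋_j θ)_j`. -/
noncomputable def PhiM : HT K (In (n + n)) →ₗ[K] (Fin (n + 1) → K) :=
  LinearMap.pi fun j : Fin (n + 1) => phiM K n j

variable (n) in
/-- the square Hankel (catalecticant) matrix `H_n(q) = (q_{i+j})_{0 ≤ i, j ≤ n}`. -/
def Hsq (q : ℕ → K) : Matrix (Fin (n + 1)) (Fin (n + 1)) K :=
  Matrix.of fun i j => q ((i : ℕ) + (j : ℕ))

/-- unfolding of `ι₊`. -/
lemma iotaP_apply (x : Fin (n + 1) → K) : iotaP K n x = ∑ l : Fin (n + 1), x l • eps K n n n l := by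
  simp only [iotaP, Fintype.linearCombination_apply]

/-- unfolding of `ι₋`. -/
lemma iotaM_apply (x : Fin (n + 1) → K) : iotaM K n x = ∑ j : Fin (n + 1), x j • eps K n 0 n j := by
  simp only [iotaM, Fintype.linearCombination_apply]

/-- unfolding of `Φ₊`. -/
lemma PhiP_apply (θ : HT K (In (n + n))) (l : Fin (n + 1)) : PhiP K n θ l = phiP K n l θ := rfl

/-- unfolding of `Φ₋`. -/
lemma PhiM_apply (θ : HT K (In (n + n))) (j : Fin (n + 1)) : PhiM K n θ j = phiM K n j θ := rfl

/-- `(M v)_i = Σ_j M_{ij} v_j` on `Fin (n+1)`. -/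
lemma mulVec_apply' (M : Matrix (Fin (n + 1)) (Fin (n + 1)) K) (v : Fin (n + 1) → K) (i : Fin (n + 1)) :
    M.mulVec v i = ∑ j : Fin (n + 1), M i j * v j := rfl

omit [Field K] in
/-- entries of the square Hankel matrix. -/
lemma Hsq_apply (q : ℕ → K) (i j : Fin (n + 1)) : Hsq K n q i j = q ((i : ℕ) + (j : ℕ)) := rfl

/-- `ι₊ x ∈ E₊`. -/
lemma iotaP_mem (x : Fin (n + 1) → K) : iotaP K n x ∈ Hom K (In (n + n)) (Gm (n + n) n) n := by
  rw [iotaP_apply]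
  exact Submodule.sum_mem _ fun l _ => Submodule.smul_mem _ _ (eps_mem_Hom_Gm K l)

/-- `ι₋ x ∈ E₋`. -/
lemma iotaM_mem (x : Fin (n + 1) → K) : iotaM K n x ∈ Hom K (In (n + n)) (Dm (n + n) n) n := by
  rw [iotaM_apply]
  exact Submodule.sum_mem _ fun j _ => Submodule.smul_mem _ _ (eps_mem_Hom_Dm K j)

/-- the h-part in `Fin`-indexed form. -/
lemma f_eq_sum_eps_fin (q : ℕ → K) :
    w K (n + n) (n + n) q =
      ∑ j : Fin (n + 1), ∑ l : Fin (n + 1), q ((j : ℕ) + (l : ℕ)) • (eps K n 0 n j * eps K n n n l) := by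
  rw [f_eq_sum_eps, Finset.sum_range (n := n + 1)]
  apply Finset.sum_congr rfl
  intro j _
  rw [Finset.sum_range (n := n + 1)]

/-! ### `ψ₊` and `ψ₋` factor through the type spaces -/

/-- **`ψ₊ ∣ E₊ = (−1)^{n·n} · ι₋ ∘ H ∘ Φ₊`.** -/
theorem psiP_eq (q : ℕ → K) {θ : HT K (In (n + n))} (hθ : θ ∈ Hom K (In (n + n)) (Gm (n + n) n) n) :
    psiP K n q θ = ((-1 : K) ^ (n * n)) • iotaM K n ((Hsq K n q).mulVec (PhiP K n θ)) := by
  -- the candidate g := (−1)^{nn} Σ_j (H Φ₊θ)_j eps₋ j satisfies g ∧ E_{Gm} = θ ∧ f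
  set g := ((-1 : K) ^ (n * n)) • iotaM K n ((Hsq K n q).mulVec (PhiP K n θ)) with hg
  have hgmem : g ∈ Hom K (In (n + n)) (Dm (n + n) n) n := Submodule.smul_mem _ _ (iotaM_mem K _)
  have hgf : g * B K (In (n + n)) (Gm (n + n) n) = θ * w K (n + n) (n + n) q := by
    rw [f_eq_sum_eps_fin, Finset.mul_sum, hg, iotaM_apply, Finset.smul_sum, Finset.sum_mul]
    apply Finset.sum_congr rfl
    intro j _
    rw [Finset.mul_sum, smul_mul_assoc, smul_mul_assoc, smul_smul, mulVec_apply', Finset.mul_sum,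
      Finset.sum_smul]
    apply Finset.sum_congr rfl
    intro l _
    rw [mul_smul_comm, ← mul_assoc θ, comm_of_mem_Hom K hθ (eps_mem_Hom_Dm K j), smul_mul_assoc,
      mul_assoc (eps K n 0 n j), EP_mul_eps K l hθ, mul_smul_comm, smul_smul, smul_smul, PhiP_apply, Hsq_apply]
    congr 1
    ring
  have hdiff : psiP K n q θ - g = 0 := by
    refine eq_zero_of_mul_B_eq_zero K (disjoint_Dm_Gm n)
      (Hom_le_Alg K _ _ (Submodule.sub_mem _ (psiP_mem K q hθ) hgmem)) ?_
    rw [sub_mul, psiP_mul_wp K q hθ, hgf, sub_self]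
  exact sub_eq_zero.mp hdiff

/-- **`ψ₋ ∣ E₋ = ι₊ ∘ H ∘ Φ₋`** (`E_{Dm}` has even degree and is central). -/
theorem psiM_eq (q : ℕ → K) {θ : HT K (In (n + n))} (hθ : θ ∈ Hom K (In (n + n)) (Dm (n + n) n) n) :
    psiM K n q θ = iotaP K n ((Hsq K n q).mulVec (PhiM K n θ)) := by
  set g := iotaP K n ((Hsq K n q).mulVec (PhiM K n θ)) with hg
  have hgmem : g ∈ Hom K (In (n + n)) (Gm (n + n) n) n := iotaP_mem K _
  have heven : ((-1 : K) ^ ((Dm (n + n) n).card * n)) = 1 := by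
    rw [card_Dm_nn]
    exact Even.neg_one_pow ⟨n * n, by ring⟩
  have hgf : g * B K (In (n + n)) (Dm (n + n) n) = θ * w K (n + n) (n + n) q := by
    rw [f_eq_sum_eps_fin, Finset.mul_sum]
    simp_rw [Finset.mul_sum]
    rw [Finset.sum_comm, hg, iotaP_apply, Finset.sum_mul]
    apply Finset.sum_congr rfl
    intro l _
    rw [smul_mul_assoc, mulVec_apply', Finset.sum_smul]
    apply Finset.sum_congr rfl
    intro j _
    rw [mul_smul_comm, ← mul_assoc θ, EM_mul_eps K j hθ, smul_mul_assoc,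
      B_mul_comm_of_mem_Hom K (eps_mem_Hom_Gm K l), heven, one_smul, smul_smul, PhiM_apply, Hsq_apply,
      Nat.add_comm (l : ℕ) (j : ℕ)]
  have hdiff : psiM K n q θ - g = 0 := by
    refine eq_zero_of_mul_B_eq_zero K (disjoint_Dm_Gm n).symm
      (Hom_le_Alg K _ _ (Submodule.sub_mem _ (psiM_mem K q hθ) hgmem)) ?_
    rw [sub_mul, psiM_mul_wm K q hθ, hgf, sub_self]
  exact sub_eq_zero.mp hdiff

variable (n) in
/-- the pairing matrix `Ω′_{j,j'} = [j + j' = n] · (−1)^{j'} · C(n,j')` (= `(−1)ⁿ Ω_n` of th-7's derivation). -/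
def Omega' : Matrix (Fin (n + 1)) (Fin (n + 1)) K :=
  Matrix.of fun j j' => if (j : ℕ) + (j' : ℕ) = n then ((-1 : K) ^ (j' : ℕ)) * (n.choose (j' : ℕ) : K) else 0

/-- entries of `Ω′`. -/
lemma Omega'_apply (j j' : Fin (n + 1)) :
    Omega' K n j j' = if (j : ℕ) + (j' : ℕ) = n then ((-1 : K) ^ (j' : ℕ)) * (n.choose (j' : ℕ) : K) else 0 := rfl

/-- the `E_D`-coordinate of `E_D` is `1`. -/
lemma coord_B_self (D : Finset (In (n + n))) : (B K (In (n + n))).coord D (B K (In (n + n)) D) = 1 := by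
  rw [Basis.coord_apply, Basis.repr_self, Finsupp.single_eq_same]

/-- `((−1)^{C(n,2)})² = 1`. -/
lemma neg_one_pow_choose_sq : ((-1 : K) ^ (n.choose 2)) * (-1) ^ (n.choose 2) = 1 := by
  rw [← pow_add]
  exact Even.neg_one_pow ⟨n.choose 2, rfl⟩

/-- the pairing values: `φ₋_j(eps₋ j') = Ω′_{j,j'}`. -/
lemma phiM_eps (j j' : Fin (n + 1)) : phiM K n j (eps K n 0 n j') = Omega' K n j j' := by
  rw [phiM_apply, eps_mul_eps, pp_zero_eq, smul_smul, map_smul, coord_B_self, smul_eq_mul, mul_one,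
    Omega'_apply]
  by_cases h : (j' : ℕ) + (j : ℕ) = n
  · rw [if_pos h, if_pos (show (j : ℕ) + (j' : ℕ) = n by omega), r]
    linear_combination ((-1 : K) ^ (j' : ℕ) * (n.choose (j' : ℕ) : K)) * neg_one_pow_choose_sq K (n := n)
  · rw [if_neg h, if_neg (show ¬ ((j : ℕ) + (j' : ℕ) = n) by omega), zero_mul]

/-- the pairing values: `φ₊_l(eps₊ l') = Ω′_{l,l'}`. -/
lemma phiP_eps (l l' : Fin (n + 1)) : phiP K n l (eps K n n n l') = Omega' K n l l' := by
  rw [phiP_apply, eps_mul_eps, pp_n_eq, smul_smul, map_smul, coord_B_self, smul_eq_mul, mul_one,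
    Omega'_apply]
  by_cases h : (l' : ℕ) + (l : ℕ) = n
  · rw [if_pos h, if_pos (show (l : ℕ) + (l' : ℕ) = n by omega), r]
    linear_combination ((-1 : K) ^ (l' : ℕ) * (n.choose (l' : ℕ) : K)) * neg_one_pow_choose_sq K (n := n)
  · rw [if_neg h, if_neg (show ¬ ((l : ℕ) + (l' : ℕ) = n) by omega), zero_mul]

/-- `Φ₋ ∘ ι₋ = Ω′`. -/
lemma PhiM_iotaM (x : Fin (n + 1) → K) : PhiM K n (iotaM K n x) = (Omega' K n).mulVec x := by
  ext j
  rw [PhiM_apply, iotaM_apply, map_sum, mulVec_apply']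
  apply Finset.sum_congr rfl
  intro j' _
  rw [map_smul, phiM_eps, smul_eq_mul, mul_comm]

/-- `Φ₊ ∘ ι₊ = Ω′`. -/
lemma PhiP_iotaP (x : Fin (n + 1) → K) : PhiP K n (iotaP K n x) = (Omega' K n).mulVec x := by
  ext l
  rw [PhiP_apply, iotaP_apply, map_sum, mulVec_apply']
  apply Finset.sum_congr rfl
  intro l' _
  rw [map_smul, phiP_eps, smul_eq_mul, mul_comm]

/-! ### The compression -/

variable (n) in
/-- `M(q) := (−1)^{n·n} · H Ω′ H`. -/
def Mcomp (q : ℕ → K) : Matrix (Fin (n + 1)) (Fin (n + 1)) K :=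
  ((-1 : K) ^ (n * n)) • (Hsq K n q * Omega' K n * Hsq K n q)

variable (n) in
/-- the COMPRESSED OPERATOR `S(q) := M(q) Ω′ = (−1)^{n·n} · H Ω′ H Ω′ ∈ M_{n+1}(K)`. -/
def Scomp (q : ℕ → K) : Matrix (Fin (n + 1)) (Fin (n + 1)) K :=
  Mcomp K n q * Omega' K n

/-- **`ψ₋ψ₊ ∣ E₊ = ι₊ ∘ M(q) ∘ Φ₊`.** -/
theorem psiM_psiP_eq (q : ℕ → K) {θ : HT K (In (n + n))} (hθ : θ ∈ Hom K (In (n + n)) (Gm (n + n) n) n) :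
    psiM K n q (psiP K n q θ) = iotaP K n ((Mcomp K n q).mulVec (PhiP K n θ)) := by
  rw [psiP_eq K q hθ, map_smul, psiM_eq K q (iotaM_mem K _), PhiM_iotaM, Matrix.mulVec_mulVec,
    Matrix.mulVec_mulVec, Mcomp, Matrix.smul_mulVec, map_smul]

/-- **THE COMPRESSION THEOREM (kernel correspondence).** For `u ≠ 0`,
`E₊ ⊓ ker(ψ₋ψ₊ − u) = ι₊ (ker (S(q) − u))`. -/
theorem EP_inf_ker_schurOp_eq (q : ℕ → K) {u : K} (hu : u ≠ 0) :
    Hom K (In (n + n)) (Gm (n + n) n) n ⊓ LinearMap.ker (schurOp K n q 1 u) =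
      (LinearMap.ker (Matrix.toLin' (Scomp K n q) - u • LinearMap.id)).map (iotaP K n) := by
  apply le_antisymm
  · rintro θ ⟨hθ, hker⟩
    have hθ' : θ ∈ Hom K (In (n + n)) (Gm (n + n) n) n := hθ
    have hker' : psiM K n q (psiP K n q θ) = u • θ := by
      have h1 : schurOp K n q 1 u θ = 0 := hker
      rw [schurOp_apply, one_mul, sub_eq_zero] at h1
      exact h1
    rw [psiM_psiP_eq K q hθ'] at hker'
    -- θ = ι₊ x with x := u⁻¹ • M Φ₊ θ
    set x : Fin (n + 1) → K := u⁻¹ • (Mcomp K n q).mulVec (PhiP K n θ) with hx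
    have hθx : θ = iotaP K n x := by
      rw [hx, map_smul, hker', smul_smul, inv_mul_cancel₀ hu, one_smul]
    refine Submodule.mem_map.mpr ⟨x, ?_, hθx.symm⟩
    rw [LinearMap.mem_ker, LinearMap.sub_apply, LinearMap.smul_apply, LinearMap.id_apply, Matrix.toLin'_apply,
      Scomp, ← Matrix.mulVec_mulVec, ← PhiP_iotaP, ← hθx, sub_eq_zero, hx, smul_smul, mul_inv_cancel₀ hu,
      one_smul]
  · rintro θ hθ
    obtain ⟨x, hx, rfl⟩ := Submodule.mem_map.mp hθ
    rw [LinearMap.mem_ker, LinearMap.sub_apply, LinearMap.smul_apply, LinearMap.id_apply, Matrix.toLin'_apply,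
      sub_eq_zero, Scomp, ← Matrix.mulVec_mulVec] at hx
    refine ⟨iotaP_mem K x, ?_⟩
    show schurOp K n q 1 u (iotaP K n x) = 0
    rw [schurOp_apply, one_mul, psiM_psiP_eq K q (iotaP_mem K x), PhiP_iotaP, hx, map_smul, sub_self]

/-- **THE COMPRESSION THEOREM (dimensions).** For `u ≠ 0`,
`dim(E₊ ⊓ ker(ψ₋ψ₊ − u)) = dim ker(S(q) − u)`. -/
theorem finrank_EP_inf_ker_schurOp (q : ℕ → K) {u : K} (hu : u ≠ 0) :
    Module.finrank K ↥(Hom K (In (n + n)) (Gm (n + n) n) n ⊓ LinearMap.ker (schurOp K n q 1 u)) =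
      Module.finrank K ↥(LinearMap.ker (Matrix.toLin' (Scomp K n q) - u • LinearMap.id)) := by
  rw [EP_inf_ker_schurOp_eq K q hu]
  refine finrank_map_of_injOn K (iotaP K n) _ fun x hx h0 => ?_
  rw [LinearMap.mem_ker, LinearMap.sub_apply, LinearMap.smul_apply, LinearMap.id_apply, Matrix.toLin'_apply,
    sub_eq_zero, Scomp, ← Matrix.mulVec_mulVec, ← PhiP_iotaP, h0, map_zero, Matrix.mulVec_zero] at hx
  exact (smul_eq_zero.mp hx.symm).resolve_left hu

/-- **W-PURITY(ρ) IN CLOSED FORM (Weil type (n,n), m = n ≥ 1, `a ≠ 0`, `b ≠ 0`, every `q`, every field).**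
`finrank range(∧v ∣ HTⁿ) + 2ρ + dim ker(S(q) − ab) = C(2n,n)·ρ + 2·C(2n,n)`, i.e.
rank `= C(2n,n)(2+ρ) − 2ρ − dim ker(S(q) − ab)` with the EXPLICIT `(n+1) × (n+1)` matrix `S(q) = Scomp n q`. -/
theorem weilPurity_closedForm (hn : 1 ≤ n) (q : ℕ → K) {a b : K} (ha : a ≠ 0) (hb : b ≠ 0) :
    Module.finrank K (LinearMap.range (wedge K (n + n) n (vW K (n + n) n q a b))) +
        2 * (hankel1 K (n + n) n q).rank +
        Module.finrank K ↥(LinearMap.ker (Matrix.toLin' (Scomp K n q) - (a * b) • LinearMap.id)) =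
      (n + n).choose n * (hankel1 K (n + n) n q).rank + ((n + n).choose n + (n + n).choose n) := by
  have h1 : schurOp K n q 1 (a * b) = schurOp K n q a b := by
    rw [schurOp, schurOp, one_mul]
  rw [← finrank_EP_inf_ker_schurOp K q (mul_ne_zero ha hb), h1]
  exact weilPurity_schur K hn q ha b

/-! ### `S(q)` is th-7's `(−1)ⁿ (H_n(q) Ω_n)²` -/

variable (n) in
/-- th-7's `Ω_n := ((−1)^{n−m} C(n,m) δ_{l,n−m})_{l,m}`. -/
def Omega : Matrix (Fin (n + 1)) (Fin (n + 1)) K :=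
  Matrix.of fun l m => if (l : ℕ) + (m : ℕ) = n then ((-1 : K) ^ (n - (m : ℕ))) * (n.choose (m : ℕ) : K) else 0

/-- `Ω′ = (−1)ⁿ Ω_n`. -/
lemma Omega'_eq : Omega' K n = ((-1 : K) ^ n) • Omega K n := by
  ext j j'
  rw [Matrix.smul_apply, Omega'_apply, Omega, Matrix.of_apply, smul_eq_mul]
  split_ifs with h
  · have h1 : ((-1 : K) ^ n) = (-1) ^ (n - (j' : ℕ)) * (-1) ^ (j' : ℕ) := by
      rw [← pow_add, Nat.sub_add_cancel (by omega)]
    rw [h1]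
    have h2 : ((-1 : K) ^ (n - (j' : ℕ))) * (-1) ^ (n - (j' : ℕ)) = 1 := by
      rw [← pow_add]
      exact Even.neg_one_pow ⟨n - (j' : ℕ), rfl⟩
    linear_combination (-((-1 : K) ^ (j' : ℕ) * (n.choose (j' : ℕ) : K))) * h2
  · rw [mul_zero]

/-- `S(q) = (−1)ⁿ (H_n(q) Ω_n)²` — the printed matrix of W-PURITY(ρ) (th-7, derivation §0/§5, κ_n = 1). -/
theorem Scomp_eq (q : ℕ → K) :
    Scomp K n q = ((-1 : K) ^ n) • ((Hsq K n q * Omega K n) * (Hsq K n q * Omega K n)) := by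
  have hsq : ((-1 : K) ^ (n * n)) = (-1) ^ n := by
    rcases Nat.even_or_odd n with h | h
    · rw [h.neg_one_pow, (h.mul_left n).neg_one_pow]
    · rw [h.neg_one_pow, (h.mul h).neg_one_pow]
  have hnn : ((-1 : K) ^ n) * (-1) ^ n = 1 := by
    rw [← pow_add]
    exact Even.neg_one_pow ⟨n, rfl⟩
  rw [Scomp, Mcomp, Omega'_eq, hsq]
  simp only [Matrix.mul_smul, Matrix.smul_mul, smul_smul, Matrix.mul_assoc]
  congr 1
  linear_combination ((-1 : K) ^ n) * hnn

end Compression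

end Summit.Ventures.HSemireg.Wedge.Weil
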